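import Summits.ValiantsHypothesis.ValiantsHypothesis.Theses.CirculantFourier
import Literature.Computability.AlgebraicComplexity.ArithCircuitProofs
import Literature.Computability.AlgebraicComplexity.IMMInVPProofs
import Literature.Computability.AlgebraicComplexity.RealTauConjectureDepthFour

/-!
# Route CirculantFourier — `TargetImpliesSensitive` (item stmt-ValiantsHypothesis-6312)

`TargetImpliesSensitive : CircPermNotPComputable → SensitiveMonotoneHard`: if the circulant
permanent family `q_n(x) = per(x_{i-j})` is not p-computable over `ℂ`, then there is no `c` such
that for every `n ≥ 1` some `ε ∈ (0,1)` makes `U_n + ε · QF_n` (`U_n = (1 + ∑ μ_m)^n`,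
`QF_n = q_n(x_d := ∑_m ω^{dm} μ_m)`, `ω = e^{2πi/n}`) computable by a plain monotone fan-in-two
circuit over `ℝ≥0` of size `≤ n^c + c`.

Proof (contrapositive, the converse of the route's Hrubeš bridge): a monotone circuit for `g_n`
with `map g_n = U_n + ε QF_n` is, after extension of scalars `ℝ≥0 → ℂ`
(`ArithCircuit.Computes.map`, size unchanged), a complex circuit for `U_n + ε QF_n`; `U_n` costs
`≤ n(n+2)` gates, so `QF_n = ε⁻¹ (g_n - U_n)` costs `≤ n^c + c + n(n+2) + 3`; the Fourier
substitution is inverted by `μ_m := n⁻¹ ∑_e ω^{(n-e)m} x_e` (orthogonality of the characters of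
`ℤ/n`: `∑_m ω^{(d+n-e)m} = n [d = e]`), `n` linear forms of cost `≤ 2n` each, and the
substitution bound `L(f(g)) ≤ L(f) + ∑ L(g_i)` (`complexity_aeval_le`) gives
`L(q_n) ≤ n^c + c + 3n² + 2n + 3`, a p-bounded function.

## References

* P. Bürgisser, *Completeness and Reduction in Algebraic Complexity Theory*, Springer 2000,
  Def. 2.1–2.2, §4.1 (extension of scalars), Rem. 2.7 (substitution).
* P. Hrubeš, *On ε-sensitive monotone computations*, Comput. Complexity 29 (2020), Thm. 1 (the
  direction formalised here is the trivial converse of the bridge).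
-/

noncomputable section

-- `Summit.ValiantsHypothesis.ValiantsHypothesis.…` is the tree's mandated single-conjunct layout
-- (Sub = Summit), so the duplicated namespace component is intended.
set_option linter.dupNamespace false

namespace Summit.ValiantsHypothesis.ValiantsHypothesis.Theorems.CirculantFourierTargetImpliesSensitive

open MvPolynomial Literature.Computability.AlgebraicComplexity
open scoped BigOperators

/-- Geometric sum of an `n`-th root of unity over `Fin n`: `n` if the root is `1`, else `0`. [folklore] -/
theorem sum_pow_eq_ite (n : ℕ) (η : ℂ) (hη : η ^ n = 1) :
    ∑ m : Fin n, η ^ (m : ℕ) = if η = 1 then (n : ℂ) else 0 := by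
  rw [Fin.sum_univ_eq_sum_range (fun i => η ^ i) n]
  split_ifs with h
  · simp [h]
  · have key := geom_sum_mul η n
    rw [hη, sub_self] at key
    exact (mul_eq_zero.mp key).resolve_right (sub_ne_zero.mpr h)

/-- Divisibility bookkeeping: for `d, e < n`, `n ∣ d + (n - e)` iff `d = e`. [folklore] -/
theorem dvd_add_sub_iff {n d e : ℕ} (hd : d < n) (he : e < n) :
    n ∣ d + (n - e) ↔ d = e := by
  constructor
  · rintro ⟨q, hq⟩
    rcases q with _ | _ | q
    · omega
    · omega
    · have : n * (q + 1 + 1) = n * q + 2 * n := by ring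
      omega
  · rintro rfl
    exact ⟨1, by omega⟩

/-- Orthogonality of the characters of `ℤ/n` in the exponential form used by the route:
`∑_m ω^{dm} ω^{(n-e)m} = n·[d = e]`, `ω = exp(2πi/n)`. [folklore] -/
theorem sum_exp_mul_exp_eq_ite {n : ℕ} (hn : n ≠ 0) (d e : Fin n) :
    ∑ m : Fin n, Complex.exp (2 * Real.pi * Complex.I * ((d : ℕ) : ℂ) * ((m : ℕ) : ℂ) / (n : ℂ)) *
      Complex.exp (2 * Real.pi * Complex.I * ((n - (e : ℕ) : ℕ) : ℂ) * ((m : ℕ) : ℂ) / (n : ℂ)) =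
    if d = e then (n : ℂ) else 0 := by
  set ζ : ℂ := Complex.exp (2 * Real.pi * Complex.I / (n : ℂ)) with hζ
  have hprim : IsPrimitiveRoot ζ n := Complex.isPrimitiveRoot_exp n hn
  have key : ∀ (a : ℕ) (m : Fin n),
      Complex.exp (2 * Real.pi * Complex.I * (a : ℂ) * ((m : ℕ) : ℂ) / (n : ℂ)) = (ζ ^ a) ^ (m : ℕ) := by
    intro a m
    rw [← pow_mul, hζ, ← Complex.exp_nat_mul]
    congr 1
    push_cast
    ring
  simp_rw [key, ← mul_pow, ← pow_add]
  have hηn : (ζ ^ ((d : ℕ) + (n - (e : ℕ)))) ^ n = 1 := by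
    rw [← pow_mul, mul_comm, pow_mul, hprim.pow_eq_one, one_pow]
  have hiff : ζ ^ ((d : ℕ) + (n - (e : ℕ))) = 1 ↔ d = e := by
    rw [hprim.pow_eq_one_iff_dvd, dvd_add_sub_iff d.isLt e.isLt, Fin.ext_iff]
  rw [sum_pow_eq_ite n _ hηn]
  simp only [hiff]

/-- The inverse Fourier substitution undoes the forward one on each variable:
`(∑_m ω^{dm} μ_m)(μ_m := n⁻¹ ∑_e ω^{(n-e)m} x_e) = x_d`. [folklore] -/
theorem aeval_invFourier_fourierForm {n : ℕ} (hn : n ≠ 0) (d : Fin n) :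
    aeval (fun m : Fin n => ∑ e : Fin n,
        C (Complex.exp (2 * Real.pi * Complex.I * ((n - (e : ℕ) : ℕ) : ℂ) * ((m : ℕ) : ℂ) / (n : ℂ)) / (n : ℂ)) *
          (X e : MvPolynomial (Fin n) ℂ))
      (∑ m : Fin n, C (Complex.exp (2 * Real.pi * Complex.I * ((d : ℕ) : ℂ) * ((m : ℕ) : ℂ) / (n : ℂ))) *
        (X m : MvPolynomial (Fin n) ℂ)) = X d := by
  simp only [map_sum, map_mul, aeval_C, aeval_X, MvPolynomial.algebraMap_eq]
  simp_rw [Finset.mul_sum, ← mul_assoc, ← C_mul]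
  rw [Finset.sum_comm]
  simp_rw [← Finset.sum_mul, ← map_sum, mul_div_assoc', ← Finset.sum_div,
    sum_exp_mul_exp_eq_ite hn]
  have hn' : (n : ℂ) ≠ 0 := Nat.cast_ne_zero.mpr hn
  have : ∀ e : Fin n, C ((if d = e then (n : ℂ) else 0) / (n : ℂ)) * (X e : MvPolynomial (Fin n) ℂ) =
      if d = e then X e else 0 := by
    intro e
    split_ifs <;> simp [hn']
  simp_rw [this]
  rw [Finset.sum_ite_eq]
  simp

/-- Powers: `L(f^k) ≤ k · (L(f) + 1)` (repeated multiplication). [folklore] -/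
theorem complexity_pow_le {k : Type*} [CommSemiring k] {σ : Type*} (f : MvPolynomial σ k) (m : ℕ) :
    complexity (f ^ m) ≤ m * (complexity f + 1) := by
  induction m with
  | zero =>
    rw [pow_zero, ← C_1, complexity_C_holds]
    exact Nat.zero_le _
  | succ m ih =>
    rw [pow_succ]
    calc complexity (f ^ m * f) ≤ complexity (f ^ m) + complexity f + 1 := complexity_mul_le_holds _ _
      _ ≤ m * (complexity f + 1) + complexity f + 1 := by gcongr
      _ = (m + 1) * (complexity f + 1) := by ring

/-- A linear form in `n` variables costs at most `2n` gates. [folklore] -/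
theorem complexity_linearForm_le {n : ℕ} (a : Fin n → ℂ) :
    complexity (∑ e : Fin n, C (a e) * (X e : MvPolynomial (Fin n) ℂ)) ≤ 2 * n := by
  have h1 : ∑ e : Fin n, complexity (C (a e) * (X e : MvPolynomial (Fin n) ℂ)) ≤ ∑ _e : Fin n, 1 := by
    refine Finset.sum_le_sum fun e _ => ?_
    calc complexity (C (a e) * (X e : MvPolynomial (Fin n) ℂ))
        ≤ complexity (C (a e) : MvPolynomial (Fin n) ℂ) + complexity (X e : MvPolynomial (Fin n) ℂ) + 1 :=
          complexity_mul_le_holds _ _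
      _ = 1 := by rw [complexity_C_holds, complexity_X_holds]
  have h2 := complexity_finset_sum_le (Finset.univ : Finset (Fin n))
    (fun e => C (a e) * (X e : MvPolynomial (Fin n) ℂ))
  simp only [Finset.sum_const, Finset.card_univ, Fintype.card_fin, smul_eq_mul, mul_one] at h1 h2
  omega

/-- The dense polynomial `U_n = (1 + ∑ μ_i)^n` costs at most `n (n + 2)` gates. [folklore] -/
theorem complexity_U_le (n : ℕ) :
    complexity ((1 + ∑ i : Fin n, X i : MvPolynomial (Fin n) ℂ) ^ n) ≤ n * (n + 2) := by
  have h0 : complexity (∑ i : Fin n, (X i : MvPolynomial (Fin n) ℂ)) ≤ n := by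
    have h := complexity_finset_sum_le (Finset.univ : Finset (Fin n))
      (fun i => (X i : MvPolynomial (Fin n) ℂ))
    rw [Finset.sum_eq_zero (fun i _ => complexity_X_holds (k := ℂ) (σ := Fin n) i), zero_add,
      Finset.card_univ, Fintype.card_fin] at h
    exact h
  have h1 : complexity (1 + ∑ i : Fin n, X i : MvPolynomial (Fin n) ℂ) ≤ n + 1 := by
    calc _ ≤ complexity (1 : MvPolynomial (Fin n) ℂ) +
          complexity (∑ i : Fin n, (X i : MvPolynomial (Fin n) ℂ)) + 1 := complexity_add_le_holds _ _
      _ ≤ 0 + n + 1 := by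
          gcongr
          rw [← C_1, complexity_C_holds]
      _ = n + 1 := by ring
  calc _ ≤ n * (complexity (1 + ∑ i : Fin n, X i : MvPolynomial (Fin n) ℂ) + 1) := complexity_pow_le _ _
    _ ≤ n * (n + 1 + 1) := by gcongr
    _ = n * (n + 2) := by ring

/-- **The transfer** (abstract in the two substitutions). If a fan-in-two circuit `P` over `ℝ≥0` of
size `≤ n^c + c` computes `g`, `g = U_n + ε · q(L) ` over `ℂ` with `ε ≠ 0`, and `M` inverts `L`
(`(L d)(M) = x_d`) with each `M m` of complexity `≤ 2n`, then `L_ℂ(q) ≤ n^c + c + 3n² + 2n + 3`: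
map the circuit along `ℝ≥0 → ℂ`, subtract `U_n`, divide by `ε`, substitute `M`
(Bürgisser 2000, §4.1 and Rem. 2.7 for the bookkeeping). [folklore] -/
theorem complexity_le_of_monotone {n c : ℕ} {ε : ℂ} (q : MvPolynomial (Fin n) ℂ)
    (g : MvPolynomial (Fin n) NNReal) (P : ArithCircuit NNReal (Fin n))
    (L M : Fin n → MvPolynomial (Fin n) ℂ)
    (hg : MvPolynomial.map (Complex.ofRealHom.comp NNReal.toRealHom) g =
      (1 + ∑ i : Fin n, X i) ^ n + C ε * aeval L q)
    (hε : ε ≠ 0) (hLM : ∀ d, aeval M (L d) = X d) (hM : ∀ m, complexity (M m) ≤ 2 * n)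
    (hfan : P.IsFanInTwo) (hcomp : P.Computes g) (hsize : P.size ≤ n ^ c + c) :
    complexity q ≤ n ^ c + c + 3 * n ^ 2 + 2 * n + 3 := by
  -- (1) the mapped monotone circuit computes `map φ g`
  have h1 : complexity (MvPolynomial.map (Complex.ofRealHom.comp NNReal.toRealHom) g) ≤ n ^ c + c := by
    calc _ ≤ (P.map (Complex.ofRealHom.comp NNReal.toRealHom)).size :=
          ArithCircuit.complexity_le_size (hfan.map _) (hcomp.map _)
      _ = P.size := ArithCircuit.size_map _ P
      _ ≤ _ := hsize
  -- (2) solve for `q(L)`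
  have hQF_eq : aeval L q = ε⁻¹ • (MvPolynomial.map (Complex.ofRealHom.comp NNReal.toRealHom) g +
      (-1 : ℂ) • (1 + ∑ i : Fin n, X i : MvPolynomial (Fin n) ℂ) ^ n) := by
    have hCC : C ε⁻¹ * C ε = (1 : MvPolynomial (Fin n) ℂ) := by
      rw [← C_mul, inv_mul_cancel₀ hε, C_1]
    rw [hg, smul_eq_C_mul, smul_eq_C_mul, map_neg, map_one]
    linear_combination (-(aeval L q)) * hCC
  have hUc := complexity_U_le n
  have h3 : complexity (aeval L q) ≤ n ^ c + c + n * (n + 2) + 3 := by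
    rw [hQF_eq]
    calc _ ≤ complexity (MvPolynomial.map (Complex.ofRealHom.comp NNReal.toRealHom) g +
            (-1 : ℂ) • (1 + ∑ i : Fin n, X i : MvPolynomial (Fin n) ℂ) ^ n) + 1 :=
          complexity_smul_le_holds _ _
      _ ≤ (complexity (MvPolynomial.map (Complex.ofRealHom.comp NNReal.toRealHom) g) +
            complexity ((-1 : ℂ) • (1 + ∑ i : Fin n, X i : MvPolynomial (Fin n) ℂ) ^ n) + 1) + 1 := by
          gcongr
          exact complexity_add_le_holds _ _
      _ ≤ (complexity (MvPolynomial.map (Complex.ofRealHom.comp NNReal.toRealHom) g) +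
            (complexity ((1 + ∑ i : Fin n, X i : MvPolynomial (Fin n) ℂ) ^ n) + 1) + 1) + 1 := by
          gcongr
          exact complexity_smul_le_holds _ _
      _ ≤ ((n ^ c + c) + (n * (n + 2) + 1) + 1) + 1 := by gcongr
      _ = _ := by ring
  -- (3) invert the substitution
  have hq : aeval M (aeval L q) = q := by
    rw [comp_aeval_apply, show (fun i => aeval M (L i)) = X from funext hLM, aeval_X_left_apply]
  calc complexity q = complexity (aeval M (aeval L q)) := by rw [hq]
    _ ≤ complexity (aeval L q) + ∑ m : Fin n, complexity (M m) := complexity_aeval_le _ _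
    _ ≤ (n ^ c + c + n * (n + 2) + 3) + ∑ _m : Fin n, 2 * n := by
        gcongr with m _
        exact hM m
    _ = _ := by
        simp only [Finset.sum_const, Finset.card_univ, Fintype.card_fin, smul_eq_mul]
        ring

end Summit.ValiantsHypothesis.ValiantsHypothesis.Theorems.CirculantFourierTargetImpliesSensitive

namespace Summit.ValiantsHypothesis.ValiantsHypothesis.Theorems

open MvPolynomial Literature.Computability.AlgebraicComplexity
open CirculantFourierTargetImpliesSensitive

/-- **Item `TargetImpliesSensitive` (stmt-ValiantsHypothesis-6312).** If the circulant permanent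
family `q_n = per(circulant x)` is not p-computable over `ℂ`, then `SensitiveMonotoneHard` holds:
there is no `c` such that for every `n ≥ 1` some `ε ∈ (0,1)` makes `U_n + ε · QF_n` computable by a
plain monotone circuit of size `≤ n^c + c`. Contrapositive: such circuits give, after extension of
scalars `ℝ≥0 → ℂ`, subtraction of `U_n`, division by `ε` and the inverse Fourier substitution
`μ_m := n⁻¹ ∑_e ω^{(n-e)m} x_e`, circuits for `q_n` of size `n^c + c + 3n² + 2n + 3`, so `q` is
p-computable. [folklore] -/
theorem targetImpliesSensitive_proof :
    Summit.ValiantsHypothesis.ValiantsHypothesis.Theses.CirculantFourier.TargetImpliesSensitive := by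
  unfold Theses.CirculantFourier.TargetImpliesSensitive Theses.CirculantFourier.CircPermNotPComputable
    Theses.CirculantFourier.SensitiveMonotoneHard
  intro hX hS
  apply hX
  obtain ⟨c, hc⟩ := hS
  unfold IsPComputable
  have hbound : ∀ n : ℕ,
      complexity (Matrix.circulant fun i : Fin n => (MvPolynomial.X i : MvPolynomial (Fin n) ℂ)).permanent ≤
        n ^ c + c + 3 * n ^ 2 + 2 * n + 3 +
          complexity (Matrix.circulant fun i : Fin 0 => (MvPolynomial.X i : MvPolynomial (Fin 0) ℂ)).permanent := by
    intro n
    rcases Nat.eq_zero_or_pos n with rfl | hn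
    · exact Nat.le_add_left _ _
    · obtain ⟨ε, hε0, -, g, P, hg, hP, hsize⟩ := hc n hn
      obtain ⟨hfan, -, hcomp⟩ := hP
      have hε' : (ε : ℂ) ≠ 0 := Complex.ofReal_ne_zero.mpr hε0.ne'
      have h := complexity_le_of_monotone _ g P _
        (fun m : Fin n => ∑ e : Fin n, C (Complex.exp (2 * Real.pi * Complex.I * ((n - (e : ℕ) : ℕ) : ℂ) *
          ((m : ℕ) : ℂ) / (n : ℂ)) / (n : ℂ)) * (X e : MvPolynomial (Fin n) ℂ))
        hg hε' (fun d => aeval_invFourier_fourierForm hn.ne' d) (fun m => complexity_linearForm_le _)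
        hfan hcomp hsize
      exact h.trans (Nat.le_add_right _ _)
  have hB : IsPBounded fun n : ℕ => n ^ c + c + 3 * n ^ 2 + 2 * n + 3 +
      complexity (Matrix.circulant fun i : Fin 0 => (MvPolynomial.X i : MvPolynomial (Fin 0) ℂ)).permanent := by
    refine IsPBounded.add_holds (s := fun n : ℕ => n ^ c + c + 3 * n ^ 2 + 2 * n + 3) ?_ (IsPBounded.const _)
    refine IsPBounded.add_holds (s := fun n : ℕ => n ^ c + c + 3 * n ^ 2 + 2 * n) ?_ (IsPBounded.const 3)
    refine IsPBounded.add_holds (s := fun n : ℕ => n ^ c + c + 3 * n ^ 2) (t := fun n => 2 * n) ?_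
      (IsPBounded.mul_holds (IsPBounded.const 2) IsPBounded.id)
    refine IsPBounded.add_holds (s := fun n : ℕ => n ^ c + c) (t := fun n => 3 * n ^ 2) ?_
      (IsPBounded.mul_holds (IsPBounded.const 3) (IsPBounded.pow_holds IsPBounded.id 2))
    exact ⟨c, fun n => le_rfl⟩
  exact hB.mono hbound

end Summit.ValiantsHypothesis.ValiantsHypothesis.Theorems
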